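import Mathlib
import HarnessLib
import Literature.MathematicalPhysics.KineticTheory.HardSphereEulerProofs
import Literature.MathematicalPhysics.KineticTheory.HardSphereEulerLLN
import Literature.MathematicalPhysics.KineticTheory.HardSphereTwoTimePressure
import Literature.Analysis.FunctionSpaces.TorusHolderBridge
import Literature.Analysis.FluidPDE.HardSpherePhaseSpaceProofs
import Summits.AtomisticToContinuum.HydrodynamicLimit.Theses.OneFlightGossipEngine
import Summits.AtomisticToContinuum.HydrodynamicLimit.Theorems.JParityClosureParityInBandSmoothTest
import Summits.AtomisticToContinuum.HydrodynamicLimit.Theorems.OneFlightGossipEngineLocalClampedTransferLDAlongFamiliesEosFieldFamilyModulus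
import Summits.AtomisticToContinuum.HydrodynamicLimit.Theorems.OneFlightGossipEngineLocalClampedTransferLDAlongFamiliesWindowEnergyExpMoment
import Summits.AtomisticToContinuum.HydrodynamicLimit.Theorems.OneFlightGossipEngineLocalClampedTransferLDAlongFamiliesSAxisNetPrelim
import Summits.AtomisticToContinuum.HydrodynamicLimit.Theorems.OneFlightGossipEngineLocalClampedTransferLDAlongFamiliesSAxisNetPathwise

/-!
# Sanity anchor: `LCT♯` with the tilt threshold chosen AFTER the budget is a static theorem — line `Sketch`,
# crux `LocalClampedTransferLDAlongFamilies` (stmt-AtomisticToContinuum-17691)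

Route `OneFlightGossipEngine`, sub-problem `HydrodynamicLimit`. The single node left open by line `Sketch` is `LCTSharp`
(`∃V₀ ∀V ∃β₀ ∀β ∀ε ∃τ₀ ∀τ ∃N₀ ∀N`). This file certifies WHERE its content lies: with the binders `∀ε ∃β₀` SWAPPED (tilt after
budget) — and then even for every clamp level `V ≥ 0`, every window `τ > 0` and EVERY `N` — the four rows are bounded by
`e^{ε(N+1)}` by statics alone: pathwise, on good orbits, the transfer-CLAMPED rows satisfy `|w⁻¹X| ≤ L V (N+1)/2`
(`abs_inv_window_mul_clampedRow_le`, `L` the Lipschitz constant of the test function across contacts), the x-frozen EOS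
projection satisfies `|w⁻¹A| ≤ (ω₁ + C)(N+1) + ω₂·(window energy)` (one-body shape bound with continuous, hence bounded,
coefficient fields in the EOS chart — `stub_eosFieldFamilyModulus` at a constant family), and the window energy has a small
exponential moment (`stub_windowEnergyExpMoment`); so `∫e^{βY} ≤ e^{|β|K(N+1)}e^{ε(N+1)/2} ≤ e^{ε(N+1)}` once
`|β| ≤ β₀(ε) := min(ε/(2K+2), γ(ε/2)/(ω₂+1))`. Hence the dynamical content of `LCTSharp` is exactly the order `∃β₀ ∀ε`
(an LD upper bound with vanishing pressure at FIXED tilt), as for the kinetic twin's `KCWUSharpPlus`.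

References: S. Olla, S. R. S. Varadhan, H.-T. Yau, Comm. Math. Phys. 155 (1993) §3; H. Spohn, *Large Scale Dynamics of
Interacting Particles* (1991), Part I §2.3.
-/

noncomputable section

open MeasureTheory Set Filter
open scoped ENNReal Topology BigOperators NNReal

namespace Summit.AtomisticToContinuum.HydrodynamicLimit.Theorems.LocalClampedTransferSketch

open Literature.Analysis.FluidPDE (HardSphereFlow Config localMaxwellian canonicalDensity liouville)
open Literature.MathematicalPhysics.KineticTheory (T3 V3 hsDiameter localGibbsLaw localGibbsProfile rhoLim
  profileOf hsCompressibility)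
open Literature.Analysis.FluidPDE Literature.MathematicalPhysics.KineticTheory Literature.Analysis.FunctionSpaces
open Summit.AtomisticToContinuum.HydrodynamicLimit.Theorems (exists_abs_le_of_continuous_T3)

/-! ### Small statics -/

/-- A smooth test function is Lipschitz for the minimal-image distance: `|φ x − φ y| ≤ 3√3·Lφ·d(x,y)` when `|∂ₖφ| ≤ Lφ`. -/
theorem abs_sub_le_of_partialDeriv_le {φ : T3 → ℝ} (hφ : Torus.IsSmooth φ) {Lφ : ℝ} (hLφ0 : 0 ≤ Lφ)
    (hLφ : ∀ (k : Fin 3) x, |Torus.partialDeriv k φ x| ≤ Lφ) (x y : T3) :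
    |φ x - φ y| ≤ Real.sqrt 3 * (3 * Lφ) * Torus.euclidDist x y := by
  have hL := Torus.lipschitzWith_of_norm_partialDeriv_le (hφ.isContDiff (by simp)) (M := fun _ => Lφ.toNNReal)
    (fun k z => by rw [Real.norm_eq_abs]; exact (hLφ k z).trans (Real.le_coe_toNNReal _))
  have h := hL.dist_le_mul x y
  rw [Real.dist_eq, dist_eq_norm] at h
  have hK : ((NNReal.sqrt (Fintype.card (Fin 3)) * ∑ _i : Fin 3, Lφ.toNNReal : ℝ≥0) : ℝ) = Real.sqrt 3 * (3 * Lφ) := by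
    push_cast
    rw [Real.coe_toNNReal _ hLφ0, Finset.sum_const, Finset.card_univ, Fintype.card_fin]
    simp [nsmul_eq_mul]
  rw [hK] at h
  exact h.trans (mul_le_mul_of_nonneg_left (Torus.norm_sub_le_euclidDist_holds x y) (by positivity))

/-- `β(x − y) ≤ |β|(|x| + |y|)`. -/
theorem mul_sub_le_abs (β x y : ℝ) : β * (x - y) ≤ |β| * (|x| + |y|) := by
  have h := abs_le.1 (show |β * (x - y)| ≤ |β| * (|x| + |y|) by
    rw [abs_mul]; exact mul_le_mul_of_nonneg_left (abs_sub _ _) (abs_nonneg _))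
  exact h.2

/-- The exponent bookkeeping: `|β|K ≤ ε/2` and `ε/2`-moment give `ε`. -/
theorem exp_budget {β K ε n : ℝ} (hn : 0 ≤ n) (hβ : |β| * K ≤ ε / 2) :
    ENNReal.ofReal (Real.exp (|β| * K * n)) * ENNReal.ofReal (Real.exp (ε / 2 * n)) ≤
      ENNReal.ofReal (Real.exp (ε * n)) := by
  rw [← ENNReal.ofReal_mul (Real.exp_nonneg _), ← Real.exp_add]
  refine ENNReal.ofReal_le_ofReal (Real.exp_le_exp.2 ?_)
  nlinarith [mul_le_mul_of_nonneg_right hβ hn]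

/-- The pathwise combination of the three bounds of a row: `β(x − i(a − c)) ≤ |β|(X₁ + A₁ + C₁)`. -/
theorem row_pathwise_le {β x i a c X₁ A₁ C₁ : ℝ} (hx : |x| ≤ X₁) (ha : |i * a| ≤ A₁) (hc : |i * c| ≤ C₁) :
    β * (x - i * (a - c)) ≤ |β| * (X₁ + A₁ + C₁) := by
  have h1 : |i * (a - c)| ≤ A₁ + C₁ := by rw [mul_sub]; exact (abs_sub _ _).trans (add_le_add ha hc)
  exact (mul_sub_le_abs β x _).trans (mul_le_mul_of_nonneg_left (by linarith) (abs_nonneg β))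

/-- The final arithmetic of a row: `b(LVn/2 + (ω₁n + ω₂W) + C n) ≤ b(LV/2 + ω₁ + (C + C′))n + bω₂W` for `b, n, C′ ≥ 0`. -/
theorem row_final_le {b L V n ω₁ ω₂ W C C' : ℝ} (hb : 0 ≤ b) (hn : 0 ≤ n) (hC' : 0 ≤ C') :
    b * (L * V * n / 2 + (ω₁ * n + ω₂ * W) + C * n) ≤ b * (L * V / 2 + ω₁ + (C + C')) * n + b * ω₂ * W := by
  have e : b * (L * V / 2 + ω₁ + (C + C')) * n + b * ω₂ * W - b * (L * V * n / 2 + (ω₁ * n + ω₂ * W) + C * n) =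
      b * C' * n := by ring
  nlinarith [mul_nonneg (mul_nonneg hb hC') hn]

/-- The same with the roles of `C` and `C′` exchanged (energy row). -/
theorem row_final_le' {b L V n ω₁ ω₂ W C C' : ℝ} (hb : 0 ≤ b) (hn : 0 ≤ n) (hC : 0 ≤ C) :
    b * (L * V * n / 2 + (ω₁ * n + ω₂ * W) + C' * n) ≤ b * (L * V / 2 + ω₁ + (C + C')) * n + b * ω₂ * W := by
  have e : b * (L * V / 2 + ω₁ + (C + C')) * n + b * ω₂ * W - b * (L * V * n / 2 + (ω₁ * n + ω₂ * W) + C' * n) =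
      b * C * n := by ring
  nlinarith [mul_nonneg (mul_nonneg hb hC) hn]

/-! ### The anchor -/

set_option maxHeartbeats 1600000 in -- one declaration: the four 4000-character rows of the node elaborated once
/-- **`LCT♯` with the tilt chosen after the budget is STATIC** (sanity anchor of the open stub `stub_lctSharp`, line `Sketch`,
crux stmt-AtomisticToContinuum-17691): with `∀ε ∃β₀` in place of `∃β₀ … ∀ε`, the four transfer-clamped, EOS-projected, centred
window rows of `LCTSharp` are bounded by `e^{ε(N+1)}` for EVERY clamp level `V ≥ 0`, window `τ > 0` and `N` (no `V₀, τ₀, N₀`):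
pathwise clamp bound of the rows, one-body bound of the EOS projection with bounded coefficient fields in the EOS chart, small
exponential moment of the window energy. The packing guard `η₁` only keeps the x-frozen EOS fields in their charts. -/
theorem stub_lctSharpTiltAfterBudget :
    ∃ η₁ : ℝ, 0 < η₁ ∧ ∀ σ : ℝ, 0 < σ → σ < 1 / 2 → ∀ V : ℝ, 0 ≤ V →
    ∀ (a θ₀ : T3 → ℝ) (u₀ : T3 → V3) (ha : Continuous a), Continuous θ₀ → Continuous u₀ →
    ∀ (ha0 : ∀ x, 0 < a x), (∀ x, 0 < θ₀ x) →
    σ ^ 3 * (⨆ x, a x) ≤ η₁ * ∫ x, a x →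
    ∀ Φ : (N : ℕ) → HardSphereFlow (Torus.geometry (Fin 3)) (hsDiameter σ N) (N + 1),
    ∀ φ : T3 → ℝ, Torus.IsSmooth φ →
    ∀ ε : ℝ, 0 < ε → ∃ β₀ : ℝ, 0 < β₀ ∧ ∀ β : ℝ, |β| ≤ β₀ → ∀ τ : ℝ, 0 < τ → ∀ N : ℕ,
      (let ρ₀ : T3 → ℝ := rhoLim (profileOf a ha ha0) σ
       let w : ℝ := τ * ((N : ℝ) + 1) ^ (-(1 / 3 : ℝ))
       let P := localGibbsLaw σ a u₀ θ₀ N (Φ N)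
       let Z : T3 → ℝ := fun x => hsCompressibility (ρ₀ x * σ ^ 3)
       let Z' : T3 → ℝ := fun x => deriv hsCompressibility (ρ₀ x * σ ^ 3)
       let act := fun (i : Fin (N + 1)) z => σ / τ * (Φ N).collisionSum (Set.Ioc 0 w)
         (fun c => if c.fst = i then ‖c.postVel.1 - c.preVel.1‖ + |‖c.postVel.1‖ ^ 2 - ‖c.preVel.1‖ ^ 2| / 2
           else 0) z
       let ω := fun (i : Fin (N + 1)) z => if act i z ≤ V then (1 : ℝ) else 0
       let Xm := fun (k : Fin 3) z => (Φ N).collisionSum (Set.Ioc 0 w)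
         (fun c => ω c.fst z * ω c.snd z * ((φ c.fstPos - φ c.sndPos) * (c.postVel.1 k - c.preVel.1 k)) / 2) z
       let Am := fun (k : Fin 3) z => (∫ r in (0 : ℝ)..w, ∑ i : Fin (N + 1),
           Torus.partialDeriv k φ ((Φ N).flow r z i).1 *
             (θ₀ ((Φ N).flow r z i).1 * (ρ₀ ((Φ N).flow r z i).1 * σ ^ 3) * Z' ((Φ N).flow r z i).1 +
               (1 / 3) * (Z ((Φ N).flow r z i).1 - 1) * ‖((Φ N).flow r z i).2 - u₀ ((Φ N).flow r z i).1‖ ^ 2)) -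
         w * ((N : ℝ) + 1) * ∫ x, ρ₀ x * Torus.partialDeriv k φ x * (θ₀ x * (ρ₀ x * σ ^ 3) * Z' x)
       let Xe := fun z => (Φ N).collisionSum (Set.Ioc 0 w)
         (fun c => ω c.fst z * ω c.snd z *
           ((φ c.fstPos - φ c.sndPos) * ((‖c.postVel.1‖ ^ 2 - ‖c.preVel.1‖ ^ 2) / 2)) / 2) z
       let Ae := fun z => (∫ r in (0 : ℝ)..w, ∑ i : Fin (N + 1),
           ((∑ l : Fin 3, u₀ ((Φ N).flow r z i).1 l * Torus.partialDeriv l φ ((Φ N).flow r z i).1) *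
               (θ₀ ((Φ N).flow r z i).1 * (ρ₀ ((Φ N).flow r z i).1 * σ ^ 3) * Z' ((Φ N).flow r z i).1 +
                 (1 / 3) * (Z ((Φ N).flow r z i).1 - 1) * ‖((Φ N).flow r z i).2 - u₀ ((Φ N).flow r z i).1‖ ^ 2) +
             θ₀ ((Φ N).flow r z i).1 * (Z ((Φ N).flow r z i).1 - 1) *
               (∑ l : Fin 3, Torus.partialDeriv l φ ((Φ N).flow r z i).1 *
                 (((Φ N).flow r z i).2 - u₀ ((Φ N).flow r z i).1) l))) -
         w * ((N : ℝ) + 1) * ∫ x, ρ₀ x * (∑ l : Fin 3, u₀ x l * Torus.partialDeriv l φ x) *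
           (θ₀ x * (ρ₀ x * σ ^ 3) * Z' x)
       (∀ k : Fin 3, ∫⁻ z, ENNReal.ofReal (Real.exp (β * (w⁻¹ * Xm k z - w⁻¹ * Am k z))) ∂P ≤
           ENNReal.ofReal (Real.exp (ε * ((N : ℝ) + 1)))) ∧
         ∫⁻ z, ENNReal.ofReal (Real.exp (β * (w⁻¹ * Xe z - w⁻¹ * Ae z))) ∂P ≤
           ENNReal.ofReal (Real.exp (ε * ((N : ℝ) + 1)))) := by
  obtain ⟨η₁, hη₁, hE⟩ := stub_eosFieldFamilyModulus
  refine ⟨η₁, hη₁, ?_⟩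
  intro σ hσ hσ2 V hV a θ₀ u₀ ha hθ hu ha0 hθ0 hguard Φ φ hφ ε hε
  -- EOS fields of the (constant) family `s ↦ a` are continuous on `𝕋³` (slice at `s = 0`)
  obtain ⟨hρc, hZc, hZ'c⟩ := hE 0 (fun _ => a) (fun _ => ha) (by fun_prop) (fun _ => ha0) σ hσ hσ2 (fun _ _ => hguard)
  have h00 : (0 : ℝ) ∈ Icc 0 0 := ⟨le_rfl, le_rfl⟩
  have hρs : Continuous fun x => rhoLim (profileOf a ha ha0) σ x := continuous_slice_of_continuousOn hρc h00
  have hZs : Continuous fun x => hsCompressibility (rhoLim (profileOf a ha ha0) σ x * σ ^ 3) := continuous_slice_of_continuousOn hZc h00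
  have hZ's : Continuous fun x => deriv hsCompressibility (rhoLim (profileOf a ha ha0) σ x * σ ^ 3) :=
    continuous_slice_of_continuousOn hZ'c h00
  -- the test function: derivative bounds and the Lipschitz constant across contacts
  obtain ⟨Lφ, hLφ0, hLφ1, -⟩ := exists_abs_partialDeriv_le hφ
  set L : ℝ := Real.sqrt 3 * (3 * Lφ) with hL
  have hL0 : 0 ≤ L := by positivity
  have hLip : ∀ x y : T3, |φ x - φ y| ≤ L * Torus.euclidDist x y := abs_sub_le_of_partialDeriv_le hφ hLφ0 hLφ1
  have hdφ : ∀ k : Fin 3, Continuous fun x => Torus.partialDeriv k φ x := fun k => (hφ.partialDeriv k).continuous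
  have hvec : ∀ l : Fin 3, Continuous fun v : V3 => v l := fun l => by fun_prop
  -- the coefficient fields and their bounds
  set BF : T3 → ℝ := fun x => θ₀ x * (rhoLim (profileOf a ha ha0) σ x * σ ^ 3) * deriv hsCompressibility (rhoLim (profileOf a ha ha0) σ x * σ ^ 3) with hBF
  set pm : Fin 3 → T3 → ℝ := fun k x => Torus.partialDeriv k φ x * BF x with hpm
  set qm : Fin 3 → T3 → ℝ := fun k x => Torus.partialDeriv k φ x * ((1 / 3) * (hsCompressibility (rhoLim (profileOf a ha ha0) σ x * σ ^ 3) - 1))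
    with hqm
  set sF : T3 → ℝ := fun x => ∑ l : Fin 3, u₀ x l * Torus.partialDeriv l φ x with hsF
  set pe : T3 → ℝ := fun x => sF x * BF x with hpe
  set qe : T3 → ℝ := fun x => sF x * ((1 / 3) * (hsCompressibility (rhoLim (profileOf a ha ha0) σ x * σ ^ 3) - 1)) with hqe
  set re : T3 → Fin 3 → ℝ := fun x l => θ₀ x * (hsCompressibility (rhoLim (profileOf a ha ha0) σ x * σ ^ 3) - 1) * Torus.partialDeriv l φ x
    with hre
  have hBFc : Continuous BF := (hθ.mul (hρs.mul continuous_const)).mul hZ's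
  have hpmc : ∀ k, Continuous (pm k) := fun k => (hdφ k).mul hBFc
  have hqmc : ∀ k, Continuous (qm k) := fun k => (hdφ k).mul (continuous_const.mul (hZs.sub continuous_const))
  have hul : ∀ l : Fin 3, Continuous fun x => u₀ x l := fun l => (hvec l).comp hu
  have hsFc : Continuous sF := continuous_finsetSum _ fun l _ => (hul l).mul (hdφ l)
  have hpec : Continuous pe := hsFc.mul hBFc
  have hqec : Continuous qe := hsFc.mul (continuous_const.mul (hZs.sub continuous_const))
  have hrec : ∀ l, Continuous fun x => re x l := fun l => (hθ.mul (hZs.sub continuous_const)).mul (hdφ l)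
  obtain ⟨U, hU0, hU⟩ := exists_abs_le_of_continuous_T3 hu.norm
  have hU' : ∀ x, ‖u₀ x‖ ≤ U := fun x => (le_abs_self _).trans (hU x)
  choose Pm hPm0 hPm using fun k => exists_abs_le_of_continuous_T3 (hpmc k)
  choose Qm hQm0 hQm using fun k => exists_abs_le_of_continuous_T3 (hqmc k)
  obtain ⟨Pe, hPe0, hPe⟩ := exists_abs_le_of_continuous_T3 hpec
  obtain ⟨Qe, hQe0, hQe⟩ := exists_abs_le_of_continuous_T3 hqec
  choose Re hRe0 hRe using fun l => exists_abs_le_of_continuous_T3 (hrec l)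
  obtain ⟨Cm, hCm0, hCm⟩ : ∃ C : ℝ, 0 ≤ C ∧ ∀ k, |∫ x, rhoLim (profileOf a ha ha0) σ x * Torus.partialDeriv k φ x * BF x| ≤ C := by
    refine ⟨∑ k, |∫ x, rhoLim (profileOf a ha ha0) σ x * Torus.partialDeriv k φ x * BF x|, Finset.sum_nonneg fun k _ => abs_nonneg _,
      fun k => ?_⟩
    exact Finset.single_le_sum (f := fun k => |∫ x, rhoLim (profileOf a ha ha0) σ x * Torus.partialDeriv k φ x * BF x|)
      (fun k _ => abs_nonneg _) (Finset.mem_univ k)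
  set Ce : ℝ := |∫ x, rhoLim (profileOf a ha ha0) σ x * sF x * BF x| with hCe
  have hCe0 : 0 ≤ Ce := abs_nonneg _
  -- one constant dominating every row: `K (N+1) + ω₂·(window energy)`
  set P : ℝ := (∑ k, Pm k) + Pe with hP
  set Q : ℝ := (∑ k, Qm k) + Qe with hQ
  set Rr : ℝ := ∑ l, Re l with hRr
  set ω₁ : ℝ := P + 2 * Q * U ^ 2 + 0 * 0 * (1 + 2 * U) + 3 * (Rr * (1 + U) + 0 * 0) with hω₁
  set ω₂ : ℝ := 2 * Q + 0 * 0 + 3 * Rr with hω₂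
  set K : ℝ := L * V / 2 + ω₁ + (Cm + Ce) with hK
  have hP0 : 0 ≤ P := add_nonneg (Finset.sum_nonneg fun k _ => hPm0 k) hPe0
  have hQ0 : 0 ≤ Q := add_nonneg (Finset.sum_nonneg fun k _ => hQm0 k) hQe0
  have hRr0 : 0 ≤ Rr := Finset.sum_nonneg fun l _ => hRe0 l
  have hω₂0 : 0 ≤ ω₂ := by rw [hω₂]; positivity
  have hK0 : 0 ≤ K := by rw [hK, hω₁]; positivity
  have hPmP : ∀ k, Pm k ≤ P := fun k =>
    (Finset.single_le_sum (fun k _ => hPm0 k) (Finset.mem_univ k)).trans (le_add_of_nonneg_right hPe0)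
  have hQmQ : ∀ k, Qm k ≤ Q := fun k =>
    (Finset.single_le_sum (fun k _ => hQm0 k) (Finset.mem_univ k)).trans (le_add_of_nonneg_right hQe0)
  have hPeP : Pe ≤ P := le_add_of_nonneg_left (Finset.sum_nonneg fun k _ => hPm0 k)
  have hQeQ : Qe ≤ Q := le_add_of_nonneg_left (Finset.sum_nonneg fun k _ => hQm0 k)
  have hReR : ∀ l, Re l ≤ Rr := fun l => Finset.single_le_sum (fun l _ => hRe0 l) (Finset.mem_univ l)
  -- the window-energy exponent at budget `ε/2`, then `β₀`
  obtain ⟨γ, hγ, hT⟩ := stub_windowEnergyExpMoment 0 (fun _ => a) (fun _ => θ₀) (fun _ => u₀) (by fun_prop) (by fun_prop)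
    (by fun_prop) (fun _ => ha0) (fun _ => hθ0) σ hσ hσ2.le (ε / 2) (by positivity)
  refine ⟨min (ε / (2 * K + 2)) (γ / (ω₂ + 1)), by positivity, fun β hβ τ hτ N => ?_⟩
  have hβK : |β| * K ≤ ε / 2 := by
    have h1 : |β| ≤ ε / (2 * K + 2) := hβ.trans (min_le_left _ _)
    calc |β| * K ≤ ε / (2 * K + 2) * K := mul_le_mul_of_nonneg_right h1 hK0
      _ = ε / 2 * (K / (K + 1)) := by field_simp
      _ ≤ ε / 2 * 1 := mul_le_mul_of_nonneg_left ((div_le_one (by positivity)).2 (by linarith)) (by positivity)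
      _ = ε / 2 := mul_one _
  have hβγ : |β| * ω₂ ≤ γ := by
    have h1 : |β| ≤ γ / (ω₂ + 1) := hβ.trans (min_le_right _ _)
    calc |β| * ω₂ ≤ γ / (ω₂ + 1) * ω₂ := mul_le_mul_of_nonneg_right h1 hω₂0
      _ = γ * (ω₂ / (ω₂ + 1)) := by field_simp
      _ ≤ γ * 1 := mul_le_mul_of_nonneg_left ((div_le_one (by positivity)).2 (by linarith)) hγ.le
      _ = γ := mul_one _
  have hnn : (0 : ℝ) ≤ (N : ℝ) + 1 := by positivity
  have hwpos : 0 < (τ * ((N : ℝ) + 1) ^ (-(1 / 3 : ℝ))) := mul_pos hτ (Real.rpow_pos_of_pos (by positivity) _)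
  have hPgood : (localGibbsLaw σ a u₀ θ₀ N (Φ N)) (Φ N).goodᶜ = 0 :=
    localGibbsLaw_absolutelyContinuous σ _ _ _ N (Φ N) (Φ N).measure_compl_good
  have hT' := hT Φ τ hτ N 0 h00
  -- the rows
  dsimp only
  refine ⟨fun k' => ?_, ?_⟩
  · set G : T3 × V3 → ℝ := fun y => Torus.partialDeriv k' φ y.1 *
        (θ₀ y.1 * (rhoLim (profileOf a ha ha0) σ y.1 * σ ^ 3) * deriv hsCompressibility (rhoLim (profileOf a ha ha0) σ y.1 * σ ^ 3) +
          (1 / 3) * (hsCompressibility (rhoLim (profileOf a ha ha0) σ y.1 * σ ^ 3) - 1) * ‖y.2 - u₀ y.1‖ ^ 2) with hG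
    have hGsh : ∀ y, G y = pm k' y.1 + qm k' y.1 * ‖y.2 - u₀ y.1‖ ^ 2 + ∑ l : Fin 3, (0 : ℝ) * (y.2 - u₀ y.1) l := by
      intro y; simp only [hG, hpm, hqm, hBF, Finset.sum_const_zero, zero_mul, add_zero]; ring
    have hG0 : ∀ y, |G y - (fun _ => (0 : ℝ)) y| ≤ ω₁ + ω₂ * ‖y.2‖ ^ 2 := by
      intro y
      have e0 : (fun _ : T3 × V3 => (0 : ℝ)) y = 0 + 0 * ‖y.2 - u₀ y.1‖ ^ 2 + ∑ l : Fin 3, (0 : ℝ) * (y.2 - u₀ y.1) l := by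
        simp
      rw [hGsh, e0]
      have h := abs_shape_sub_le (p := pm k' y.1) (p' := 0) (q := qm k' y.1) (q' := 0) (ωp := P) (ωq := Q)
        (r := fun _ => (0 : ℝ)) (r' := fun _ => (0 : ℝ)) (ωr := 0) (ωu := 0) (Q := 0) (R := 0) (u := u₀ y.1)
        (u' := u₀ y.1) (by rw [sub_zero]; exact (hPm k' y.1).trans (hPmP k')) (by rw [sub_zero]; exact (hQm k' y.1).trans (hQmQ k'))
        (fun _ => by simp) (by simp) (by simp) (fun _ => by simp) (hU' y.1) (hU' y.1) hQ0 le_rfl le_rfl y.2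
      refine h.trans ?_
      rw [hω₁, hω₂]
      nlinarith [sq_nonneg ‖y.2‖, mul_nonneg hRr0 (sq_nonneg ‖y.2‖), mul_nonneg hRr0 hU0]
    have hGc : Continuous G := by
      rw [show G = _ from funext hGsh]
      refine (((hpmc k').comp continuous_fst).add (((hqmc k').comp continuous_fst).mul
        ((continuous_snd.sub (hu.comp continuous_fst)).norm.pow 2))).add ?_
      exact continuous_finsetSum _ fun l _ => continuous_const.mul ((hvec l).comp (continuous_snd.sub (hu.comp continuous_fst)))
    refine le_trans (lintegral_exp_le_of_pathwise_windowEnergy (Φ N) hPgood (c := |β| * K * ((N : ℝ) + 1))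
      (γ' := |β| * ω₂) hwpos hβγ fun z hz => ?_) ?_
    · have hX := abs_inv_window_mul_clampedRow_le hσ hτ hV hL0 (Φ N) hz (ψ := φ) hLip
        (δ := fun v v' : V3 => v' k' - v k') (fun v v' => by
          have h := PiLp.norm_apply_le (v' - v) k'
          rw [Real.norm_eq_abs, PiLp.sub_apply] at h
          exact h.trans (le_add_of_nonneg_right (by positivity)))
      have hA := abs_inv_window_mul_sub_le (Φ N) hz hGc continuous_const hG0 hwpos
      have hC : |(τ * ((N : ℝ) + 1) ^ (-(1 / 3 : ℝ)))⁻¹ * ((τ * ((N : ℝ) + 1) ^ (-(1 / 3 : ℝ))) * ((N : ℝ) + 1) * ∫ x, rhoLim (profileOf a ha ha0) σ x * Torus.partialDeriv k' φ x * BF x)| ≤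
          Cm * ((N : ℝ) + 1) := by
        rw [← mul_assoc, ← mul_assoc, inv_mul_cancel₀ hwpos.ne', one_mul, abs_mul, abs_of_nonneg hnn, mul_comm]
        exact mul_le_mul_of_nonneg_right (hCm k') hnn
      have hsum0 : (∫ r in (0 : ℝ)..(τ * ((N : ℝ) + 1) ^ (-(1 / 3 : ℝ))), ∑ i : Fin (N + 1),
          (fun _ : T3 × V3 => (0 : ℝ)) ((Φ N).flow r z i)) = 0 := by simp
      rw [hsum0, sub_zero] at hA
      push_cast at hA
      simp only [hBF] at hC
      refine (row_pathwise_le hX hA hC).trans ?_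
      rw [hK]
      exact row_final_le (abs_nonneg β) hnn hCe0
    · exact (mul_le_mul' le_rfl hT').trans (exp_budget hnn hβK)
  · set G : T3 × V3 → ℝ := fun y =>
        (∑ l : Fin 3, u₀ y.1 l * Torus.partialDeriv l φ y.1) *
          (θ₀ y.1 * (rhoLim (profileOf a ha ha0) σ y.1 * σ ^ 3) * deriv hsCompressibility (rhoLim (profileOf a ha ha0) σ y.1 * σ ^ 3) +
            (1 / 3) * (hsCompressibility (rhoLim (profileOf a ha ha0) σ y.1 * σ ^ 3) - 1) * ‖y.2 - u₀ y.1‖ ^ 2) +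
        θ₀ y.1 * (hsCompressibility (rhoLim (profileOf a ha ha0) σ y.1 * σ ^ 3) - 1) *
          (∑ l : Fin 3, Torus.partialDeriv l φ y.1 * (y.2 - u₀ y.1) l) with hG
    have hmul3 : ∀ (c : ℝ) (f g : Fin 3 → ℝ), c * ∑ l, f l * g l = ∑ l, (c * f l) * g l := fun c f g => by
      rw [Finset.mul_sum]; exact Finset.sum_congr rfl fun l _ => by ring
    have hGsh : ∀ y, G y = pe y.1 + qe y.1 * ‖y.2 - u₀ y.1‖ ^ 2 + ∑ l : Fin 3, re y.1 l * (y.2 - u₀ y.1) l := by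
      intro y; simp only [hG, hpe, hqe, hre, hsF, hBF, hmul3]; ring
    have hG0 : ∀ y, |G y - (fun _ => (0 : ℝ)) y| ≤ ω₁ + ω₂ * ‖y.2‖ ^ 2 := by
      intro y
      have e0 : (fun _ : T3 × V3 => (0 : ℝ)) y = 0 + 0 * ‖y.2 - u₀ y.1‖ ^ 2 + ∑ l : Fin 3, (0 : ℝ) * (y.2 - u₀ y.1) l := by
        simp
      rw [hGsh, e0]
      have h := abs_shape_sub_le (p := pe y.1) (p' := 0) (q := qe y.1) (q' := 0) (ωp := P) (ωq := Q)
        (r := re y.1) (r' := fun _ => (0 : ℝ)) (ωr := Rr) (ωu := 0) (Q := 0) (R := 0) (u := u₀ y.1)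
        (u' := u₀ y.1) (by rw [sub_zero]; exact (hPe y.1).trans hPeP) (by rw [sub_zero]; exact (hQe y.1).trans hQeQ)
        (fun l => by rw [sub_zero]; exact (hRe l y.1).trans (hReR l)) (by simp) (by simp) (fun _ => by simp) (hU' y.1)
        (hU' y.1) hQ0 hRr0 le_rfl y.2
      refine h.trans (le_of_eq ?_)
      rw [hω₁, hω₂]
    have hGc : Continuous G := by
      rw [show G = _ from funext hGsh]
      refine ((hpec.comp continuous_fst).add ((hqec.comp continuous_fst).mul
        ((continuous_snd.sub (hu.comp continuous_fst)).norm.pow 2))).add ?_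
      exact continuous_finsetSum _ fun l _ =>
        ((hrec l).comp continuous_fst).mul ((hvec l).comp (continuous_snd.sub (hu.comp continuous_fst)))
    refine le_trans (lintegral_exp_le_of_pathwise_windowEnergy (Φ N) hPgood (c := |β| * K * ((N : ℝ) + 1))
      (γ' := |β| * ω₂) hwpos hβγ fun z hz => ?_) ?_
    · have hX := abs_inv_window_mul_clampedRow_le hσ hτ hV hL0 (Φ N) hz (ψ := φ) hLip
        (δ := fun v v' : V3 => (‖v'‖ ^ 2 - ‖v‖ ^ 2) / 2) (fun v v' => by
          rw [abs_div, abs_two]; exact le_add_of_nonneg_left (norm_nonneg _))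
      have hA := abs_inv_window_mul_sub_le (Φ N) hz hGc continuous_const hG0 hwpos
      have hC : |(τ * ((N : ℝ) + 1) ^ (-(1 / 3 : ℝ)))⁻¹ * ((τ * ((N : ℝ) + 1) ^ (-(1 / 3 : ℝ))) * ((N : ℝ) + 1) * ∫ x, rhoLim (profileOf a ha ha0) σ x * sF x * BF x)| ≤ Ce * ((N : ℝ) + 1) := by
        rw [← mul_assoc, ← mul_assoc, inv_mul_cancel₀ hwpos.ne', one_mul, abs_mul, abs_of_nonneg hnn, mul_comm]
      have hsum0 : (∫ r in (0 : ℝ)..(τ * ((N : ℝ) + 1) ^ (-(1 / 3 : ℝ))), ∑ i : Fin (N + 1),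
          (fun _ : T3 × V3 => (0 : ℝ)) ((Φ N).flow r z i)) = 0 := by simp
      rw [hsum0, sub_zero] at hA
      push_cast at hA
      simp only [hBF, hsF] at hC
      refine (row_pathwise_le hX hA hC).trans ?_
      rw [hK]
      exact row_final_le' (abs_nonneg β) hnn hCm0
    · exact (mul_le_mul' le_rfl hT').trans (exp_budget hnn hβK)

end Summit.AtomisticToContinuum.HydrodynamicLimit.Theorems.LocalClampedTransferSketch

end
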